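import Literature.NumberTheory.Irrationality.RhinViola1996.PermutationGroupZeta2
import Literature.NumberTheory.Transcendental.BeukersZetaThreeIntegralsOffDiagProofs
import Literature.NumberTheory.Transcendental.PeriodsWave0
import Literature.NumberTheory.Transcendental.BoxIntegralZetaValues
import HarnessLib

/-!
# Rhin–Viola 1996 — the base of Theorem 2.1: Beukers' lemma for `ζ(2)` in the vocabulary `I(h,i,j,k,l)`

Topic `Literature/NumberTheory/Irrationality/RhinViola1996` (file 3 of 5 of the topic; files 1–2 are denom-lit g44's
`PermutationGroupZeta2{,Proofs}.lean` — the integrals (2.1) `I(h,i,j,k,l)` over the open square and their permutation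
group; files 4–5 `TheoremTwoOneBase.lean`, `TheoremTwoOne.lean` prove Theorem 2.1). Source: G. Rhin, C. Viola,
*On a permutation group related to ζ(2)*, Acta Arith. **77** (1996) 23–56 [RhinViola1996], §2, proof of Lemma 2.1
(p. 29, held text `paper:doi-10-4064-aa-77-1-23-56`, read on the page): "Lemma 2.1 (Beukers [1]). If `i + j − l ≤ 0`,
then Theorem 2.1 holds. Proof. If `i + j − l < 0`, since `∫₀¹∫₀¹ x^r y^s dx dy = 1/((r+1)(s+1))` for `r, s ≥ 0`, we have
`J₀ ∈ ℚ` … If `i + j − l = 0`, by Lemma 1.1 in [7] we have `J₀ = a − bζ(2)` …" — i.e. the base of the descent is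
F. Beukers' lemma on the double integrals `∫₀¹∫₀¹ x^r y^s dx dy/(1 − xy)` (*A note on the irrationality of `ζ(2)` and
`ζ(3)`*, Bull. London Math. Soc. 11 (1979) 268–272, Lemma 1(a)), whose `ζ(3)` half (the `−log(xy)` kernels) is the
tree's `Transcendental/BeukersZetaThreeIntegrals*.lean` and whose `ζ(2)` half was absent (the unweighted case
`r = s = 0`, `∫∫ dx dy/(1−xy) = π²/6`, is `Transcendental/BoxIntegralZetaValues.lean`; Rhin–Viola's 2005 dilogarithm
version, `DiophantineApproximation/RhinViolaTheorem21.lean`, is for `z > 1` only).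

PROVED here, for all `r s : ℕ`, about `I(r,0,0,s,0) = ∫∫_{(0,1)²} x^r y^s dx dy/(1−xy)` (the member `h = r`, `k = s`,
`i = j = l = 0` of (2.1), `integrand_monomial`):

* `integrableOn_and_I_monomial_eq_tsum` — the kernel is integrable on the open square and
  `I(r,0,0,s,0) = Σ_{t≥0} 1/((r+t+1)(s+t+1))` (geometric series, term-wise integration of non-negative terms:
  `integrableOn_and_integral_eq_tsum`, a monotone-convergence lemma stated for reuse);
* `I_monomial_diag` — `I(r,0,0,r,0) = ζ(2) − Σ_{m=1}^{r} m⁻²` (`ζ(2) = zetaValue 2` of `PeriodsWave0.lean`);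
* `I_monomial_offDiag` (`s < r`) / `I_monomial_offDiag'` (`r < s`, by `σ`) — `I(r,0,0,s,0) = (H_r − H_s)/(r − s)
  = (Σ_{s<m≤r} 1/m)/(r−s) ∈ ℚ` (partial fractions and a telescoping harmonic tail, `hasSum_inv_sub_inv_succ`).

* FINITENESS of (2.1) (p. 27: "the condition for `I(h,i,j,k,l)` to be finite is that `h, i, j, k, l` are all
  non-negative"): `integrand_natCast` (normal form `x^h(1−x)^i y^k(1−y)^j(1−xy)^l/(1−xy)^{i+j+1}` on the open square) and
  `integrableOn_integrand_natCast` — at natural parameters the integrand is dominated by Beukers' kernel `1/(1−xy)`, whose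
  integrability on the open square (with `∫∫ = π²/6`) is the tree's `box_integral_one_div_one_sub_mul_two`
  (`Transcendental/BoxIntegralZetaValues.lean`, REUSED, not re-proved; bridge `I_zero_eq_pi_sq_div_six`).

The arithmetic consequences (`d_M d_N`-integrality) and Lemma 2.1 itself are in `TheoremTwoOneBase.lean`.
HONEST FRAMING (cell pub-zeta5: systematic search; no irrationality claim unless certified): classical identities for
double integrals of rational functions (1979/1996) typed-and-proved; no irrationality measure, no denominator record,
nothing about `ζ(5)`; records in print unmoved.

## References
* [RhinViola1996] G. Rhin, C. Viola, Acta Arith. 77 (1996) 23–56, §2 Lemma 2.1 (p. 29).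
* [Beukers1979] F. Beukers, Bull. London Math. Soc. 11 (1979) 268–272, Lemma 1 (the original; cited through
  [RhinViola1996], not re-read here).
-/

noncomputable section

open MeasureTheory Set Filter Topology
open scoped ENNReal

namespace Literature.NumberTheory.Irrationality.RhinViola1996

open Literature.NumberTheory.Transcendental (zetaValue box_integral_one_div_one_sub_mul_two)
open Literature.NumberTheory.Transcendental.Beukers (integral_pow_Ioo_zero_one
  integrableOn_pow_Ioo_zero_one measurableSet_unitSq integrableOn_unitSq_mul_and_integral_eq
  summable_one_div_sq_shift tsum_one_div_sq_shift)

/-! ### The open square: elementary facts -/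

/-- The open square of this file is literally the set `{p | ∀ i, p i ∈ (0,1)}` of the tree's Beukers files.
[cite: RhinViola1996, §2 (2.1), p. 27] -/
theorem square_eq : square = {p : Fin 2 → ℝ | ∀ i, p i ∈ Ioo (0 : ℝ) 1} := rfl

/-- On the open square (the domain of (2.1)) the denominator `1 − xy` is positive. [cite: RhinViola1996, §2 (2.1), p. 27] -/
theorem one_sub_mul_pos {p : Fin 2 → ℝ} (hp : p ∈ square) : 0 < 1 - p 0 * p 1 := by
  have h0 := hp 0
  have h1 := hp 1
  nlinarith [mul_nonneg (sub_nonneg.2 h0.2.le) h1.1.le, h1.2]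

/-- On the open square `xy < 1`. [folklore] -/
private theorem mul_lt_one_of_mem_square {p : Fin 2 → ℝ} (hp : p ∈ square) : p 0 * p 1 < 1 := by
  linarith [one_sub_mul_pos hp]

/-! ### Term-wise integration of a series of non-negative functions -/

/-- Term-wise integration (monotone convergence in the form needed here): if `F k ≥ 0` are integrable on a
measurable set `s`, `∑ F k = f` pointwise on `s` with `f` a.e.-strongly measurable there, and the integrals
`∫_s F k` are summable, then `f` is integrable on `s` and `∫_s f = ∑ ∫_s F k`. [folklore] -/
private theorem integrableOn_and_integral_eq_tsum {X : Type*} [MeasurableSpace X] {μ : Measure X} {s : Set X}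
    (hs : MeasurableSet s) {F : ℕ → X → ℝ} {f : X → ℝ} (hF : ∀ k, IntegrableOn (F k) s μ)
    (hF0 : ∀ k, ∀ x ∈ s, 0 ≤ F k x) (hsum : ∀ x ∈ s, HasSum (fun k => F k x) (f x))
    (hfm : AEStronglyMeasurable f (μ.restrict s)) (hS : Summable fun k => ∫ x in s, F k x ∂μ) :
    IntegrableOn f s μ ∧ ∫ x in s, f x ∂μ = ∑' k, ∫ x in s, F k x ∂μ := by
  have hf0 : 0 ≤ᵐ[μ.restrict s] f := by
    filter_upwards [ae_restrict_mem hs] with x hx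
    exact (hsum x hx).nonneg fun k => hF0 k x hx
  have hFk0 : ∀ k, 0 ≤ᵐ[μ.restrict s] F k := fun k => by
    filter_upwards [ae_restrict_mem hs] with x hx using hF0 k x hx
  have hI0 : ∀ k, 0 ≤ ∫ x in s, F k x ∂μ := fun k => integral_nonneg_of_ae (hFk0 k)
  -- the lower integral of `f` is the sum of the integrals of the terms
  have hlint : ∫⁻ x in s, ENNReal.ofReal (f x) ∂μ = ENNReal.ofReal (∑' k, ∫ x in s, F k x ∂μ) := by
    have h1 : ∫⁻ x in s, ENNReal.ofReal (f x) ∂μ = ∫⁻ x in s, ∑' k, ENNReal.ofReal (F k x) ∂μ := by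
      refine setLIntegral_congr_fun hs fun x hx => ?_
      rw [← (hsum x hx).tsum_eq]
      exact ENNReal.ofReal_tsum_of_nonneg (fun k => hF0 k x hx) (hsum x hx).summable
    rw [h1, lintegral_tsum fun k => (hF k).aestronglyMeasurable.aemeasurable.ennreal_ofReal,
      ENNReal.ofReal_tsum_of_nonneg hI0 hS]
    exact tsum_congr fun k => (ofReal_integral_eq_lintegral_ofReal (hF k) (hFk0 k)).symm
  have hint : IntegrableOn f s μ :=
    ⟨hfm, (hasFiniteIntegral_iff_ofReal hf0).2 (by rw [hlint]; exact ENNReal.ofReal_lt_top)⟩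
  refine ⟨hint, ?_⟩
  rw [integral_eq_lintegral_of_nonneg_ae hf0 hfm, hlint, ENNReal.toReal_ofReal (tsum_nonneg hI0)]

/-! ### The monomial kernels `x^r y^s/(1 − xy)` = the integrands of `I(r,0,0,s,0)` -/

/-- `I(r,0,0,s,0)` has the integrand `x^r y^s/(1 − xy)` (Beukers' kernel). [cite: RhinViola1996, §2 (2.1), p. 27] -/
theorem integrand_monomial (r s : ℕ) (p : Fin 2 → ℝ) :
    integrand ⟨r, 0, 0, s, 0⟩ p = p 0 ^ r * p 1 ^ s / (1 - p 0 * p 1) := by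
  simp [integrand]

/-- The geometric expansion `x^r y^s/(1 − xy) = Σ_k x^{r+k} y^{s+k}` on the open square.
[cite: RhinViola1996, §2 Lemma 2.1 (proof, "Beukers [1]"), p. 29] -/
theorem hasSum_monomial (r s : ℕ) {p : Fin 2 → ℝ} (hp : p ∈ square) :
    HasSum (fun k : ℕ => p 0 ^ (r + k) * p 1 ^ (s + k)) (p 0 ^ r * p 1 ^ s / (1 - p 0 * p 1)) := by
  have h0 := hp 0
  have h1 := hp 1
  have hs := (hasSum_geometric_of_lt_one (mul_pos h0.1 h1.1).le (mul_lt_one_of_mem_square hp)).mul_left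
    (p 0 ^ r * p 1 ^ s)
  rw [div_eq_mul_inv]
  refine hs.congr_fun fun k => ?_
  rw [mul_pow, pow_add, pow_add]
  ring

/-- The monomials `x^a y^b` are integrable on the open square with `∫∫ x^a y^b = 1/((a+1)(b+1))`.
[cite: RhinViola1996, §2 Lemma 2.1 (proof), p. 29] -/
theorem integral_monomial (a b : ℕ) :
    IntegrableOn (fun p : Fin 2 → ℝ => p 0 ^ a * p 1 ^ b) square ∧
      ∫ p in square, p 0 ^ a * p 1 ^ b = 1 / (((a : ℝ) + 1) * ((b : ℝ) + 1)) := by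
  obtain ⟨hi, hv⟩ := integrableOn_unitSq_mul_and_integral_eq
    (integrableOn_pow_Ioo_zero_one a) (integrableOn_pow_Ioo_zero_one b)
  refine ⟨hi, ?_⟩
  rw [square_eq, hv, integral_pow_Ioo_zero_one, integral_pow_Ioo_zero_one]
  rw [one_div_mul_one_div]

/-- The integrals of the terms, `1/((r+k+1)(s+k+1)) ≤ 1/(k+1)²`, are summable. [folklore] -/
private theorem summable_monomial_terms (r s : ℕ) :
    Summable fun k : ℕ => 1 / ((((r + k : ℕ) : ℝ) + 1) * (((s + k : ℕ) : ℝ) + 1)) := by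
  have h2 : Summable fun k : ℕ => 1 / ((k : ℝ) + 1) ^ 2 := by
    have := (summable_nat_add_iff 1).mpr (Real.summable_one_div_nat_pow.mpr one_lt_two)
    simpa [Nat.cast_add, Nat.cast_one] using this
  refine h2.of_nonneg_of_le (fun k => by positivity) (fun k => ?_)
  push_cast
  have hk : (0 : ℝ) < (k : ℝ) + 1 := by positivity
  have hr : (k : ℝ) + 1 ≤ (r : ℝ) + k + 1 := by linarith [(r.cast_nonneg : (0 : ℝ) ≤ r)]
  have hs : (k : ℝ) + 1 ≤ (s : ℝ) + k + 1 := by linarith [(s.cast_nonneg : (0 : ℝ) ≤ s)]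
  exact one_div_le_one_div_of_le (by positivity) (by rw [sq]; exact mul_le_mul hr hs hk.le (by linarith))

/-- The integrand of `I(r,0,0,s,0)` is continuous on the open square. [folklore] -/
private theorem continuousOn_monomial (r s : ℕ) :
    ContinuousOn (fun p : Fin 2 → ℝ => p 0 ^ r * p 1 ^ s / (1 - p 0 * p 1)) square := by
  refine ContinuousOn.div (by fun_prop) (by fun_prop) fun p hp => (one_sub_mul_pos hp).ne'

/-- **Beukers' expansion for `ζ(2)`**: the kernel `x^r y^s/(1 − xy)` is integrable on the open square and
`I(r,0,0,s,0) = ∫∫ x^r y^s/(1−xy) dx dy = Σ_{k ≥ 0} 1/((r+k+1)(s+k+1))` ("since `∫∫ x^r y^s = 1/((r+1)(s+1))`",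
term-wise integration of the geometric series). [cite: RhinViola1996, §2 Lemma 2.1 (proof), p. 29] -/
theorem integrableOn_and_I_monomial_eq_tsum (r s : ℕ) :
    IntegrableOn (integrand ⟨r, 0, 0, s, 0⟩) square ∧
      I ⟨r, 0, 0, s, 0⟩ = ∑' k : ℕ, 1 / ((((r + k : ℕ) : ℝ) + 1) * (((s + k : ℕ) : ℝ) + 1)) := by
  have hfun : integrand ⟨r, 0, 0, s, 0⟩ = fun p : Fin 2 → ℝ => p 0 ^ r * p 1 ^ s / (1 - p 0 * p 1) :=
    funext (integrand_monomial r s)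
  have key := integrableOn_and_integral_eq_tsum (μ := volume) measurableSet_square
    (F := fun k p => p 0 ^ (r + k) * p 1 ^ (s + k)) (f := fun p => p 0 ^ r * p 1 ^ s / (1 - p 0 * p 1))
    (fun k => (integral_monomial (r + k) (s + k)).1)
    (fun k p hp => mul_nonneg (pow_nonneg (hp 0).1.le _) (pow_nonneg (hp 1).1.le _))
    (fun p hp => hasSum_monomial r s hp)
    ((continuousOn_monomial r s).aestronglyMeasurable measurableSet_square)
    ((summable_monomial_terms r s).congr fun k => ((integral_monomial (r + k) (s + k)).2).symm)
  refine ⟨hfun ▸ key.1, ?_⟩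
  rw [I, hfun, key.2]
  exact tsum_congr fun k => (integral_monomial (r + k) (s + k)).2

/-- Integrability of the kernel of `I(r,0,0,s,0)` on the open square. [cite: RhinViola1996, §2 p. 27] -/
theorem integrableOn_integrand_monomial (r s : ℕ) : IntegrableOn (integrand ⟨r, 0, 0, s, 0⟩) square :=
  (integrableOn_and_I_monomial_eq_tsum r s).1

/-! ### The closed forms: diagonal `ζ(2) − Σ_{m ≤ r} m⁻²`, off-diagonal `(H_r − H_s)/(r − s)` -/

/-- **Beukers' lemma for `ζ(2)`, diagonal case**: `I(r,0,0,r,0) = ∫∫ x^r y^r/(1−xy) = ζ(2) − Σ_{m=1}^{r} 1/m²`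
(`ζ(2) = zetaValue 2 = Σ' n, 1/n²`). [cite: RhinViola1996, §2 Lemma 2.1 (proof, case `i+j−l = 0`), p. 29] -/
theorem I_monomial_diag (r : ℕ) :
    I ⟨r, 0, 0, r, 0⟩ = zetaValue 2 - ∑ m ∈ Finset.range r, 1 / ((m : ℝ) + 1) ^ 2 := by
  rw [(integrableOn_and_I_monomial_eq_tsum r r).2]
  have h1 : ∑' k : ℕ, 1 / ((((r + k : ℕ) : ℝ) + 1) * (((r + k : ℕ) : ℝ) + 1)) =
      ∑' k : ℕ, 1 / ((r : ℝ) + k + 1) ^ 2 := tsum_congr fun k => by push_cast; ring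
  rw [h1, tsum_one_div_sq_shift r, zetaValue, Finset.sum_range_succ']
  have e2 : ∀ m : ℕ, (1 : ℝ) / ((m + 1 : ℕ) : ℝ) ^ 2 = 1 / ((m : ℝ) + 1) ^ 2 := by
    intro m; rw [Nat.cast_succ]
  simp_rw [e2]
  simp

/-- The telescoping harmonic series: for `1 ≤ j`, `Σ_{k ≥ 0} (1/(j+k) − 1/(j+k+1)) = 1/j`. [folklore] -/
private theorem hasSum_inv_sub_inv_succ {j : ℕ} (hj : 1 ≤ j) :
    HasSum (fun k : ℕ => 1 / ((j : ℝ) + k) - 1 / ((j : ℝ) + k + 1)) (1 / (j : ℝ)) := by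
  have hj' : (0 : ℝ) < j := by exact_mod_cast hj
  have hnonneg : ∀ k : ℕ, 0 ≤ 1 / ((j : ℝ) + k) - 1 / ((j : ℝ) + k + 1) := fun k => by
    rw [sub_nonneg]
    exact one_div_le_one_div_of_le (by positivity) (by linarith)
  rw [hasSum_iff_tendsto_nat_of_nonneg hnonneg]
  have hpart : ∀ n : ℕ, ∑ i ∈ Finset.range n, (1 / ((j : ℝ) + i) - 1 / ((j : ℝ) + i + 1)) =
      1 / (j : ℝ) - 1 / ((j : ℝ) + n) := by
    intro n
    have := Finset.sum_range_sub' (fun i : ℕ => 1 / ((j : ℝ) + i)) n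
    simp only [Nat.cast_add, Nat.cast_one, ← add_assoc] at this
    simpa using this
  simp_rw [hpart]
  have hlim : Tendsto (fun n : ℕ => 1 / ((j : ℝ) + n)) atTop (𝓝 0) := by
    have h := (tendsto_one_div_add_atTop_nhds_zero_nat (𝕜 := ℝ)).comp (tendsto_add_atTop_nat (j - 1))
    refine h.congr fun n => ?_
    simp only [Function.comp]
    push_cast [Nat.cast_sub hj]
    ring
  have hc : Tendsto (fun _ : ℕ => 1 / (j : ℝ)) atTop (𝓝 (1 / (j : ℝ))) := tendsto_const_nhds
  simpa using hc.sub hlim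

/-- The off-diagonal sum: for `s < r`, `Σ_{k ≥ 0} 1/((r+k+1)(s+k+1)) = (Σ_{s<m≤r} 1/m)/(r − s)` (partial
fractions `1/((s+k+1)(r+k+1)) = (1/(r−s))(1/(s+k+1) − 1/(r+k+1))` and telescoping).
[cite: RhinViola1996, §2 Lemma 2.1 (proof), p. 29] -/
theorem hasSum_monomial_terms_offDiag {r s : ℕ} (h : s < r) :
    HasSum (fun k : ℕ => 1 / ((((r + k : ℕ) : ℝ) + 1) * (((s + k : ℕ) : ℝ) + 1)))
      ((∑ m ∈ Finset.Ioc s r, 1 / (m : ℝ)) / ((r : ℝ) - s)) := by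
  have hd : (0 : ℝ) < (r : ℝ) - s := sub_pos.mpr (by exact_mod_cast h)
  -- finite telescoping: `Σ_{m ∈ (s, s+n]} (1/(m+k) − 1/(m+k+1)) = 1/(s+k+1) − 1/(s+n+k+1)`
  have htel : ∀ (k n : ℕ), ∑ m ∈ Finset.Ioc s (s + n), (1 / ((m : ℝ) + k) - 1 / ((m : ℝ) + k + 1)) =
      1 / ((s : ℝ) + k + 1) - 1 / ((s : ℝ) + n + k + 1) := by
    intro k n
    induction n with
    | zero => simp
    | succ n ih =>
      rw [← add_assoc, Finset.sum_Ioc_succ_top (by omega), ih]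
      push_cast
      ring
  -- each term is `(1/(r-s)) Σ_{m ∈ Ioc s r} (1/(m+k) − 1/(m+k+1))`
  have hterm : ∀ k : ℕ, 1 / ((((r + k : ℕ) : ℝ) + 1) * (((s + k : ℕ) : ℝ) + 1)) =
      (∑ m ∈ Finset.Ioc s r, (1 / ((m : ℝ) + k) - 1 / ((m : ℝ) + k + 1))) / ((r : ℝ) - s) := by
    intro k
    obtain ⟨n, rfl⟩ : ∃ n, r = s + n := ⟨r - s, by omega⟩
    rw [htel k n]
    have hA : ((s : ℝ) + n + k + 1) ≠ 0 := by positivity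
    have hB : ((s : ℝ) + k + 1) ≠ 0 := by positivity
    have hn0 : (0 : ℝ) < n := by exact_mod_cast (show 0 < n by omega)
    have hn : (s : ℝ) + n - s ≠ 0 := by linarith
    push_cast
    field_simp
    ring
  simp_rw [hterm]
  refine HasSum.div_const ?_ _
  refine hasSum_sum fun m hm => ?_
  exact hasSum_inv_sub_inv_succ (by rw [Finset.mem_Ioc] at hm; omega)

/-- **Beukers' lemma for `ζ(2)`, off-diagonal case**: for `s < r`,
`I(r,0,0,s,0) = ∫∫ x^r y^s/(1−xy) = (1/(r−s)) Σ_{m=s+1}^{r} 1/m` — a rational number ("`J₀ ∈ ℚ`").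
[cite: RhinViola1996, §2 Lemma 2.1 (proof), p. 29] -/
theorem I_monomial_offDiag {r s : ℕ} (h : s < r) :
    I ⟨r, 0, 0, s, 0⟩ = (∑ m ∈ Finset.Ioc s r, 1 / (m : ℝ)) / ((r : ℝ) - s) := by
  rw [(integrableOn_and_I_monomial_eq_tsum r s).2]
  exact (hasSum_monomial_terms_offDiag h).tsum_eq

/-- The off-diagonal case below the diagonal, by the symmetry `σ : x ↔ y` (`invariance_sigma`): for `r < s`,
`I(r,0,0,s,0) = (1/(s−r)) Σ_{m=r+1}^{s} 1/m`. [cite: RhinViola1996, §2 p. 28 and Lemma 2.1, p. 29] -/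
theorem I_monomial_offDiag' {r s : ℕ} (h : r < s) :
    I ⟨r, 0, 0, s, 0⟩ = (∑ m ∈ Finset.Ioc r s, 1 / (m : ℝ)) / ((s : ℝ) - r) := by
  have hσ := invariance_sigma ⟨s, 0, 0, r, 0⟩
  simp only [sigma] at hσ
  rw [hσ]
  exact I_monomial_offDiag h

/-! ### The integrand at natural parameters: normal form, bounds, integrability -/

/-- Normal form of the integrand (2.1) at natural parameters on the open square:
`x^h(1−x)^i y^k(1−y)^j (1−xy)^l/(1−xy)^{i+j+1}`. [cite: RhinViola1996, §2 (2.1), p. 27] -/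
theorem integrand_natCast (h i j k l : ℕ) {p : Fin 2 → ℝ} (hp : p ∈ square) :
    integrand ⟨h, i, j, k, l⟩ p = p 0 ^ h * (1 - p 0) ^ i * p 1 ^ k * (1 - p 1) ^ j * (1 - p 0 * p 1) ^ l /
      (1 - p 0 * p 1) ^ (i + j + 1) := by
  have hW := (one_sub_mul_pos hp).ne'
  simp only [integrand, zpow_natCast]
  rw [show ((i : ℤ) + j - l + 1) = ((i + j + 1 : ℕ) : ℤ) - (l : ℕ) by push_cast; ring, zpow_sub₀ hW,
    zpow_natCast, zpow_natCast, div_div_eq_mul_div]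

/-- The integrand of `I(0,0,0,0,0)` is `1/(1 − xy)`. [cite: RhinViola1996, §2 (2.1), p. 27] -/
theorem integrand_zero (p : Fin 2 → ℝ) : integrand ⟨0, 0, 0, 0, 0⟩ p = 1 / (1 - p 0 * p 1) := by
  have := integrand_monomial 0 0 p
  simp only [Nat.cast_zero, pow_zero, mul_one] at this
  exact this

/-- **Bridge to the tree's box-integral presentation of `ζ(2)`** (`Transcendental/BoxIntegralZetaValues.lean`,
`box_integral_one_div_one_sub_mul_two`: Beukers' kernel `1/(1−xy)` is integrable on the open square with integral
`π²/6`): `I(0,0,0,0,0) = π²/6` (= `ζ(2)`, cf. `I_monomial_diag 0`). Nothing of that file is re-proved: its lemma is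
the unweighted case `r = s = 0`, REUSED below for the domination argument. [cite: RhinViola1996, §1 (1.4), p. 24] -/
theorem I_zero_eq_pi_sq_div_six : I ⟨0, 0, 0, 0, 0⟩ = Real.pi ^ 2 / 6 := by
  rw [I, show integrand ⟨0, 0, 0, 0, 0⟩ = fun p : Fin 2 → ℝ => 1 / (1 - p 0 * p 1) from funext integrand_zero]
  exact box_integral_one_div_one_sub_mul_two.2

/-- On the open square the integrand at natural parameters is non-negative. [cite: RhinViola1996, §2 p. 27] -/
theorem integrand_natCast_nonneg (h i j k l : ℕ) {p : Fin 2 → ℝ} (hp : p ∈ square) :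
    0 ≤ integrand ⟨h, i, j, k, l⟩ p := by
  rw [integrand_natCast h i j k l hp]
  have h0 := hp 0; have h1 := hp 1; have hW := one_sub_mul_pos hp
  have : 0 ≤ 1 - p 0 := by linarith [h0.2]
  have : 0 ≤ 1 - p 1 := by linarith [h1.2]
  have := h0.1.le; have := h1.1.le
  positivity

/-- On the open square the integrand at natural parameters is bounded by the kernel `1/(1−xy)` of
`I(0,0,0,0,0)` (`x, y, 1−xy ≤ 1` and `1−x, 1−y ≤ 1−xy`). [cite: RhinViola1996, §2 p. 27 ("the condition for
`I(h,i,j,k,l)` to be finite is that `h, i, j, k, l` are all non-negative")] -/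
theorem integrand_natCast_le (h i j k l : ℕ) {p : Fin 2 → ℝ} (hp : p ∈ square) :
    integrand ⟨h, i, j, k, l⟩ p ≤ 1 / (1 - p 0 * p 1) := by
  rw [integrand_natCast h i j k l hp]
  have h0 := hp 0; have h1 := hp 1; have hW := one_sub_mul_pos hp
  set W := 1 - p 0 * p 1 with hWdef
  have hx1 : p 0 ^ h ≤ 1 := pow_le_one₀ h0.1.le h0.2.le
  have hy1 : p 1 ^ k ≤ 1 := pow_le_one₀ h1.1.le h1.2.le
  have hW1 : W ≤ 1 := by rw [hWdef]; nlinarith [mul_pos h0.1 h1.1]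
  have hWl : W ^ l ≤ 1 := pow_le_one₀ hW.le hW1
  have hxW : (1 - p 0) ^ i ≤ W ^ i :=
    pow_le_pow_left₀ (by linarith [h0.2]) (by rw [hWdef]; nlinarith [h0.1, h1.2]) i
  have hyW : (1 - p 1) ^ j ≤ W ^ j :=
    pow_le_pow_left₀ (by linarith [h1.2]) (by rw [hWdef]; nlinarith [h1.1, h0.2]) j
  have hN : p 0 ^ h * (1 - p 0) ^ i * p 1 ^ k * (1 - p 1) ^ j * W ^ l ≤ W ^ (i + j) := by
    have hA : p 0 ^ h * p 1 ^ k * W ^ l ≤ 1 :=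
      mul_le_one₀ (mul_le_one₀ hx1 (pow_nonneg h1.1.le _) hy1) (pow_nonneg hW.le _) hWl
    calc p 0 ^ h * (1 - p 0) ^ i * p 1 ^ k * (1 - p 1) ^ j * W ^ l
        = (p 0 ^ h * p 1 ^ k * W ^ l) * ((1 - p 0) ^ i * (1 - p 1) ^ j) := by ring
      _ ≤ 1 * (W ^ i * W ^ j) :=
          mul_le_mul hA (mul_le_mul hxW hyW (pow_nonneg (by linarith [h1.2]) _) (pow_nonneg hW.le _))
            (mul_nonneg (pow_nonneg (by linarith [h0.2]) _) (pow_nonneg (by linarith [h1.2]) _)) zero_le_one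
      _ = W ^ (i + j) := by rw [one_mul, pow_add]
  calc p 0 ^ h * (1 - p 0) ^ i * p 1 ^ k * (1 - p 1) ^ j * W ^ l / W ^ (i + j + 1)
      ≤ W ^ (i + j) / W ^ (i + j + 1) := div_le_div_of_nonneg_right hN (pow_nonneg hW.le _)
    _ = 1 / W := by
        rw [pow_succ, div_mul_eq_div_div, div_self (pow_ne_zero _ hW.ne')]

/-- The normal form is continuous on the open square. [folklore] -/
private theorem continuousOn_integrand_natCast (h i j k l : ℕ) :
    ContinuousOn (fun p : Fin 2 → ℝ => p 0 ^ h * (1 - p 0) ^ i * p 1 ^ k * (1 - p 1) ^ j *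
      (1 - p 0 * p 1) ^ l / (1 - p 0 * p 1) ^ (i + j + 1)) square :=
  ContinuousOn.div (by fun_prop) (by fun_prop) fun p hp => pow_ne_zero _ (one_sub_mul_pos hp).ne'

/-- **Finiteness of `I(h,i,j,k,l)` for non-negative parameters** (p. 27): the integrand is integrable on the
open square, being dominated by Beukers' kernel `1/(1−xy)`. [cite: RhinViola1996, §2 p. 27] -/
theorem integrableOn_integrand_natCast (h i j k l : ℕ) : IntegrableOn (integrand ⟨h, i, j, k, l⟩) square := by
  have hg : IntegrableOn (fun p : Fin 2 → ℝ => 1 / (1 - p 0 * p 1)) square :=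
    box_integral_one_div_one_sub_mul_two.1
  have hF : IntegrableOn (fun p : Fin 2 → ℝ => p 0 ^ h * (1 - p 0) ^ i * p 1 ^ k * (1 - p 1) ^ j *
      (1 - p 0 * p 1) ^ l / (1 - p 0 * p 1) ^ (i + j + 1)) square := by
    refine Integrable.mono' hg ((continuousOn_integrand_natCast h i j k l).aestronglyMeasurable
      measurableSet_square) ?_
    filter_upwards [ae_restrict_mem measurableSet_square] with p hp
    rw [Real.norm_of_nonneg (by rw [← integrand_natCast h i j k l hp]; exact integrand_natCast_nonneg h i j k l hp),
      ← integrand_natCast h i j k l hp]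
    exact integrand_natCast_le h i j k l hp
  exact hF.congr_fun (fun p hp => (integrand_natCast h i j k l hp).symm) measurableSet_square

end Literature.NumberTheory.Irrationality.RhinViola1996

end
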